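import Summits.BirchSwinnertonDyer.BirchSwinnertonDyer.Theorems.KolyvaginDepthDoorMSymbolCertKurihara
import HarnessLib

/-!
# Route `KolyvaginDepthDoor`, crux `KolyvaginDepthSupplyKN` (stmt-BirchSwinnertonDyer-22820) —
# DEPTH TABLE v30, KIT 4 supplement: the discrete-log table check `tabOK` from a GENERATOR ROW (linear, not quadratic)

Helper file of the lead prover of line `levelone` (kdd-p1 g35; `--supports stmt-BirchSwinnertonDyer-22820
--as helper`); it closes nothing and BSD is NOT proved by it.

Kit 4 (`…MSymbolCertKurihara`) feeds the Kurihara sum with logarithm tables `T ℓ : List ℕ` whose admissibility is the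
Boolean `tabOK ℓ p (T ℓ)`: multiplicativity `T[ab] ≡ T[a] + T[b] (mod p)` over ALL pairs `0 < a, b < ℓ` — `ℓ²` pairs, each with
three linear look-ups, i.e. cubic in `ℓ`; at `ℓ = 743` (level `94361 = 127·743` of the row `664a1`) one kernel evaluation no
longer fits the budget. This file proves `tabOK` from two LINEAR checks: the generator row `T[g b] ≡ T[g] + T[b]` for all
`0 < b < ℓ` (`tabRowOK`) and the logarithm check `g^{T[a]} ≡ a (mod ℓ)` for all `0 < a < ℓ` (`tabLogOK`), `ℓ` prime, `0 < g < ℓ`: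
by induction `T[gⁱ b] ≡ i T[g] + T[b]`, and every `a` is `g^{T[a]}`.
* `tabRowOK`, `tabLogOK` (decidable checks); `tabOK_of_rowCheck`.

References: [Kim2022StructureSelmer] §1.4.3 (the logarithms `ψ_ℓ`); [CremonaAlgorithms1997] §2.8.
-/

set_option linter.dupNamespace false

namespace Summit.BirchSwinnertonDyer.BirchSwinnertonDyer.Theorems.KolyvaginDepthDoor.MSymbolCert

/-! ## §1 The two linear checks -/

/-- Generator-row check: `T[(g b) mod ℓ] ≡ T[g] + T[b] (mod p)` for all `0 < b < ℓ`. [folklore] -/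
def tabRowOK (ℓ p g : ℕ) (tab : List ℕ) : Bool :=
  (List.range ℓ).all fun b => (b == 0) || (tabVal tab p ((g * b) % ℓ) == tabVal tab p g + tabVal tab p b)

/-- Logarithm check: `g ^ T[a] ≡ a (mod ℓ)` for all `0 < a < ℓ` (so `g` generates and `T` is a logarithm to base `g`). [folklore] -/
def tabLogOK (ℓ g : ℕ) (tab : List ℕ) : Bool :=
  (List.range ℓ).all fun a => (a == 0) || (g ^ (tab.getD a 0) % ℓ == a)

/-! ## §2 `tabOK` from the linear checks -/

section

variable {ℓ p g : ℕ} {tab : List ℕ}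

/-- The generator row, unfolded. [folklore] -/
theorem tabVal_mul_of_tabRowOK (hrow : tabRowOK ℓ p g tab = true) {b : ℕ} (hb : b < ℓ) (hb0 : b ≠ 0) :
    tabVal tab p ((g * b) % ℓ) = tabVal tab p g + tabVal tab p b := by
  simp only [tabRowOK, List.all_eq_true, List.mem_range, Bool.or_eq_true, beq_iff_eq] at hrow
  rcases hrow b hb with h | h
  · exact absurd h hb0
  · exact h

/-- **`T[gⁱ b] ≡ i T[g] + T[b]`** for `0 < b < ℓ`, `ℓ` prime, `ℓ ∤ g` (induction on `i` along the generator row). [folklore] -/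
theorem tabVal_pow_mul (hℓ : ℓ.Prime) (hg : ¬ ℓ ∣ g) (hrow : tabRowOK ℓ p g tab = true) :
    ∀ (i b : ℕ), b < ℓ → b ≠ 0 → tabVal tab p ((g ^ i * b) % ℓ) = (i : ZMod p) * tabVal tab p g + tabVal tab p b := by
  intro i
  induction i with
  | zero =>
    intro b hb _
    rw [pow_zero, one_mul, Nat.mod_eq_of_lt hb, Nat.cast_zero, zero_mul, zero_add]
  | succ i ih =>
    intro b hb hb0
    have hc : (g ^ i * b) % ℓ < ℓ := Nat.mod_lt _ hℓ.pos
    have hc0 : (g ^ i * b) % ℓ ≠ 0 := by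
      intro h
      have hdvd : ℓ ∣ g ^ i * b := Nat.dvd_of_mod_eq_zero h
      rcases (Nat.Prime.dvd_mul hℓ).mp hdvd with h1 | h1
      · exact hg (hℓ.dvd_of_dvd_pow h1)
      · exact hb0 (Nat.eq_zero_of_dvd_of_lt h1 hb)
    have hstep : (g ^ (i + 1) * b) % ℓ = (g * ((g ^ i * b) % ℓ)) % ℓ := by
      rw [pow_succ, Nat.mul_mod (g) ((g ^ i * b) % ℓ), Nat.mod_mod, ← Nat.mul_mod]
      ring_nf
    rw [hstep, tabVal_mul_of_tabRowOK hrow hc hc0, ih b hb hb0, Nat.cast_succ]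
    ring

/-- **`tabOK` from the generator row and the logarithm check** (`ℓ` prime, `0 < g < ℓ`): the table is multiplicative on all
pairs. [cite: Kim2022StructureSelmer, §1.4.3] -/
theorem tabOK_of_rowCheck (hℓ : ℓ.Prime) (hg0 : 0 < g) (hgℓ : g < ℓ) (hrow : tabRowOK ℓ p g tab = true)
    (hlog : tabLogOK ℓ g tab = true) : tabOK ℓ p tab = true := by
  have hg : ¬ ℓ ∣ g := fun h => absurd (Nat.le_of_dvd hg0 h) (not_le.mpr hgℓ)
  simp only [tabLogOK, List.all_eq_true, List.mem_range, Bool.or_eq_true, beq_iff_eq] at hlog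
  -- `T[1] = 0`
  have h1 : tabVal tab p 1 = 0 := by
    have h := tabVal_mul_of_tabRowOK hrow hℓ.one_lt one_ne_zero
    rw [mul_one, Nat.mod_eq_of_lt hgℓ] at h
    have := h; rwa [left_eq_add] at this
  -- every `0 < a < ℓ` is `g ^ T[a]` and `T[a] = T[a] • T[g]`
  have hval : ∀ a < ℓ, a ≠ 0 → tabVal tab p a = ((tab.getD a 0 : ℕ) : ZMod p) * tabVal tab p g := by
    intro a ha ha0
    rcases hlog a ha with h | h
    · exact absurd h ha0
    · have := tabVal_pow_mul hℓ hg hrow (tab.getD a 0) 1 hℓ.one_lt one_ne_zero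
      rw [mul_one, h, h1, add_zero] at this
      exact this
  simp only [tabOK, List.all_eq_true, List.mem_range, Bool.or_eq_true, beq_iff_eq]
  intro a ha b hb
  by_cases ha0 : a = 0
  · exact Or.inl (Or.inl ha0)
  by_cases hb0 : b = 0
  · exact Or.inl (Or.inr hb0)
  right
  rcases hlog a ha with h | h
  · exact absurd h ha0
  · have key := tabVal_pow_mul hℓ hg hrow (tab.getD a 0) b hb hb0
    rw [Nat.mul_mod, h, Nat.mod_eq_of_lt hb] at key
    rw [hval a ha ha0]
    exact key

end

end Summit.BirchSwinnertonDyer.BirchSwinnertonDyer.Theorems.KolyvaginDepthDoor.MSymbolCert
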